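import Literature.Computability.AlgebraicComplexity.BI17OddPlethysmColumnSets
import Literature.Computability.AlgebraicComplexity.BI17SL3InvariantDimensionProofs
import Literature.RepresentationTheory.GeneralLinear.PlethysmWordModel
import HarnessLib

/-!
# BI 2017 Rem. 3.13 ("`O(Sym^D ℂ^m)^{SL_m}_d` is generated by the tableau invariants `P_T`")
# reduced to ONE dictionary identity of the word model — theorem-only

P. Bürgisser, C. Ikenmeyer, *Fundamental invariants of orbit closures*, J. Algebra **477** (2017)
390–434 = arXiv:1511.02927 [BurgisserIkenmeyer2017], Rem. 3.13 (TeX `main.tex` L1100; held text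
`paper:arxiv-1511.02927` p0010): "The degree `d` invariant space `O(Sym^D ℂ^m)_d^{SL_m}` is
generated by the set of all invariants `P_T`, where `T` runs over all semistandard tableaux of
shape `m × s` with exactly `D` entries of each number `1,…,d`" (cf. Ikenmeyer 2012 §3(A)); typed
as the named fact `BI2017_rem_3_13` (`BI17FundamentalInvariantForms.lean`, `β` over all bijections
`[D] × [d] ≃ [m] × [s]`). THEOREM-ONLY file (no definitions, no named facts).

THE ROUTE (word model; everything but step (4) is a theorem of the tree or of this file):
(1) `m ∤ Dd` ⇒ the only homogeneous `SL_m`-invariant of degree `d` is `0` (the scalar matrix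
    `ζ_m · 1 ∈ SL_m` acts on `O(Sym^D)_d` by `ζ_m^{-Dd}`): `eq_zero_of_isSLInvariantCoord_of_not_dvd`;
(2) `m ∣ Dd`, `s = Dd/m`: an invariant `F` is a highest-weight vector of `coordRep` of the dual
    rectangular weight (`slInvariantsOfDegree_le_highestWeightSpace`, BI App. Cor. 7.2; the tree's
    `slInvariantsOfDegree_eq_highestWeightSpace_const`, p4, is the equality), so its
    polarisation `x = wordOfForm rev D d F` is an `S_d ≀ S_D`-invariant highest-weight vector of
    weight `□ = m × s` in `(ℂ^m)^{⊗ dD}` (`wordOfForm_mem_highestWeightSpace`, `wordPerm_wordOfForm`);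
(3) `HW_□((ℂ^m)^{⊗ ms})` is spanned by the block signs `ζ_e`
    (`highestWeightSpace_rectangle_le_span_wordBlockSign`, BI's Schur–Weyl irreducibility step),
    transported to length `dD = ms` here (`highestWeightSpace_wordRep_le_span_wordBlockSign`);
(4) THE DICTIONARY IDENTITY (hypothesis of the reductions below): the wreath average of a block
    sign is, up to a nonzero scalar, the polarisation of a tableau invariant —
    `Σ_{ω ∈ S_d × S_D^d} ω · ζ_e ∈ wordOfForm rev D d (span {P_β})` (shape "wreath"), or the same
    with the tree's Reynolds operator `blockSymmetrizer` (shape "blockSymmetrizer");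
(5) assembly (`mem_span_tableauInvPoly_of_operator`): `x = c⁻¹ A x ∈ A(span ζ_e) ⊆
    wordOfForm(span P_β)`, and `wordOfForm` is injective on forms of degree `d`
    (`eq_of_wordOfForm_eq`), the `P_β` being forms of degree `d` (`isHomogeneous_tableauInvPoly`).

Main results: `BI2017_rem_3_13_of_wreath_dictionary`, `BI2017_rem_3_13_of_blockSymmetrizer_dictionary`
(`dictionary → BI2017_rem_3_13`); the named fact itself is NOT discharged here.

Honest framing: bookkeeping for the cell `val-lit` (a published remark, reduced to one explicit
identity); VP ≠ VNP is NOT proved and nothing here bears on it.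

## References

* [BurgisserIkenmeyer2017] P. Bürgisser, C. Ikenmeyer, J. Algebra 477 (2017) 390–434 =
  arXiv:1511.02927, Rem. 3.13, eq. (3.4), §7 (Appendix) Cor. 7.2.
-/

noncomputable section

open MvPolynomial Literature.NumberTheory.DiophantineGeometry
  Literature.RepresentationTheory.GeneralLinear

namespace Literature.Computability.AlgebraicComplexity

/-! ### §1 `m ∤ Dd`: no invariants of degree `d` -/

/-- **If `m ∤ D·d` then `O(Sym^D ℂ^m)^{SL_m}_d = 0`** (`m ≥ 1`): the scalar matrix `ζ · 1`, `ζ` a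
primitive `m`-th root of unity, lies in `SL_m` and acts on a form `F` of degree `d` on `Sym^D` by
`ζ^{-Dd}` (`coordSubst_scalar_mul_toGL_of_isHomogeneous`), so `SL_m`-invariance forces
`ζ^{Dd} = 1`, i.e. `m ∣ Dd`, unless `F = 0` (BI 2017 Lemma 3.2 (2), proof: "For `g = t id_m` we have
`det(g) = t^m` and `g w = t^D w`"). [cite: BurgisserIkenmeyer2017, Lemma 3.2 (2) (proof)] -/
theorem eq_zero_of_isSLInvariantCoord_of_not_dvd {m D d : ℕ} (hm : 0 < m)
    {F : MvPolynomial (DegIdx (Fin m) D) ℂ} (hFh : F.IsHomogeneous d)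
    (hFi : IsSLInvariantCoord D F) (hndvd : ¬ m ∣ D * d) : F = 0 := by
  have hζ := Complex.isPrimitiveRoot_exp m hm.ne'
  set ζ : ℂ := Complex.exp (2 * Real.pi * Complex.I / m) with hζdef
  have hζ0 : ζ ≠ 0 := hζ.ne_zero hm.ne'
  have hdetZ : Matrix.det (ζ • (1 : Matrix (Fin m) (Fin m) ℂ)) = 1 := by
    rw [Matrix.det_smul, Matrix.det_one, mul_one, Fintype.card_fin, hζ.pow_eq_one]
  have hGL : Matrix.SpecialLinearGroup.toGL (⟨ζ • (1 : Matrix (Fin m) (Fin m) ℂ), hdetZ⟩ :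
        Matrix.SpecialLinearGroup (Fin m) ℂ) =
      Matrix.GeneralLinearGroup.scalar (Fin m) (Units.mk0 ζ hζ0) *
        Matrix.SpecialLinearGroup.toGL 1 := by
    rw [map_one, mul_one]
    refine Matrix.GeneralLinearGroup.ext fun i j => ?_
    rw [Matrix.SpecialLinearGroup.coe_GL_coe_matrix, Matrix.GeneralLinearGroup.coe_scalar,
      Matrix.scalar_apply]
    simp [Matrix.one_apply, Matrix.diagonal_apply]
  -- invariance under `ζ · 1` versus the scalar action `ζ^{-Dd}`
  have h1 := hFi ⟨ζ • (1 : Matrix (Fin m) (Fin m) ℂ), hdetZ⟩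
  rw [coordRep_apply, hGL, coordSubst_scalar_mul_toGL_of_isHomogeneous hζ0 1 hFh, map_one,
    ← coordRep_apply, map_one, Module.End.one_apply] at h1
  -- `h1 : ((ζ⁻¹) ^ D) ^ d • F = F`
  by_contra hF0
  apply hndvd
  have hpow : ((ζ⁻¹) ^ D) ^ d = 1 := by
    have h2 : (((ζ⁻¹) ^ D) ^ d - 1) • F = 0 := by rw [sub_smul, one_smul, h1, sub_self]
    rcases smul_eq_zero.mp h2 with h | h
    · exact sub_eq_zero.mp h
    · exact absurd h hF0
  rw [← pow_mul, inv_pow, inv_eq_one] at hpow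
  exact (hζ.pow_eq_one_iff_dvd _).mp hpow

/-! ### §2 `HW_□` of the word model is spanned by block signs, at any word length -/

/-- **`HW_□((ℂ^N)^{⊗ n}) ⊆ span{ζ_e}`** for a weight given by a partition `μ ⊢ n` with the parts of
the rectangle `N × b` (so `n = N b`): the tree's `highestWeightSpace_rectangle_le_span_wordBlockSign`
(length written `N * b`) transported along `n = N * b`. [cite: BurgisserIkenmeyer2017, Thm. 5.13 (proof)] -/
theorem highestWeightSpace_wordRep_le_span_wordBlockSign {n N b : ℕ} (hn : n = N * b)
    (χ : Weight (Fin N)) (hχ : χ = Weight.ofPartition N (Nat.Partition.rectangle N b)) :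
    highestWeightSpace (wordRep ℂ N n) χ ≤
      Submodule.span ℂ (Set.range fun e : Fin n ≃ Fin b × Fin N => wordBlockSign ℂ e) := by
  subst hn
  subst hχ
  exact highestWeightSpace_rectangle_le_span_wordBlockSign N b

/-! ### §3 The assembly: from an averaging operator to the span of the `P_β` -/

/-- **Rem. 3.13 from a dictionary, abstract form.** Let `m ≥ 1`, `D d = m s`, and let `A` be a
linear operator on functions on words of length `dD` over `[m]` which multiplies every
`S_d ≀ S_D`-invariant function by a fixed nonzero scalar `c` (e.g. a sum of wreath-product
translates) and maps every block sign `ζ_e` (`e : [dD] ≃ [s] × [m]`) into the polarisations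
`wordOfForm rev D d (span{P_β})` of the tableau invariants. Then every homogeneous `SL_m`-invariant
`F` of degree `d` on `Sym^D ℂ^m` lies in `span{P_β}`: `x = wordOfForm rev D d F` is a wreath-invariant
vector of `HW_□ ⊆ span{ζ_e}` (BI App. Cor. 7.2 + Schur–Weyl), so `x = c⁻¹ A x ∈ wordOfForm(span P_β)`,
and `wordOfForm` is injective on forms of degree `d`. [cite: BurgisserIkenmeyer2017, Rem. 3.13] -/
theorem mem_span_tableauInvPoly_of_operator {D d m s : ℕ} (hm : 0 < m) (hs : D * d = m * s)
    (A : (Word m (d * D) → ℂ) →ₗ[ℂ] (Word m (d * D) → ℂ)) (c : ℂ) (hc : c ≠ 0)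
    (hAinv : ∀ x : Word m (d * D) → ℂ,
      (∀ τ ∈ blockPerms d D, wordPerm ℂ τ x = x) → A x = c • x)
    (hAζ : ∀ e : Fin (d * D) ≃ Fin s × Fin m,
      ∃ P ∈ Submodule.span ℂ {P : MvPolynomial (DegIdx (Fin m) D) ℂ |
          ∃ (s' : ℕ) (β : Fin D × Fin d ≃ Fin m × Fin s'), P = tableauInvPoly D β (id : Fin m → Fin m)},
        wordOfForm (Fin.revPerm : Equiv.Perm (Fin m)) D d P = A (wordBlockSign ℂ e))
    (F : MvPolynomial (DegIdx (Fin m) D) ℂ) (hFh : F.IsHomogeneous d) (hFi : IsSLInvariantCoord D F) :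
    F ∈ Submodule.span ℂ {P : MvPolynomial (DegIdx (Fin m) D) ℂ |
      ∃ (s' : ℕ) (β : Fin D × Fin d ≃ Fin m × Fin s'), P = tableauInvPoly D β (id : Fin m → Fin m)} := by
  classical
  set S : Set (MvPolynomial (DegIdx (Fin m) D) ℂ) := {P | ∃ (s' : ℕ) (β : Fin D × Fin d ≃ Fin m × Fin s'),
    P = tableauInvPoly D β (id : Fin m → Fin m)} with hS_def
  -- `wordOfForm` as a linear map
  let L : MvPolynomial (DegIdx (Fin m) D) ℂ →ₗ[ℂ] (Word m (d * D) → ℂ) :=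
    { toFun := wordOfForm (Fin.revPerm : Equiv.Perm (Fin m)) D d
      map_add' := fun h h' => wordOfForm_add (k := ℂ) _ h h'
      map_smul' := fun a h => wordOfForm_smul _ a h }
  have hL : ∀ P, L P = wordOfForm (Fin.revPerm : Equiv.Perm (Fin m)) D d P := fun _ => rfl
  -- (2) `F` is a highest-weight vector of the dual rectangular weight; so is its polarisation
  have hdvd : m ∣ D * d := ⟨s, hs⟩
  have hsm : D * d / m = s := by rw [hs, Nat.mul_div_cancel_left _ hm]
  have hFmem : F ∈ slInvariantsOfDegree (Fin m) ℂ D d :=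
    (mem_slInvariantsOfDegree_iff D d F).mpr ⟨hFh, hFi⟩
  have hFhw := slInvariantsOfDegree_le_highestWeightSpace hm hdvd hFmem
  have hxHW := wordOfForm_mem_highestWeightSpace (M := m) strictAnti_revPerm hFh hFhw
  have hxinv : ∀ τ ∈ blockPerms d D,
      wordPerm ℂ τ (wordOfForm (Fin.revPerm : Equiv.Perm (Fin m)) D d F) =
        wordOfForm (Fin.revPerm : Equiv.Perm (Fin m)) D d F := fun τ hτ =>
    wordPerm_wordOfForm _ F hτ
  -- (3) `x ∈ span{ζ_e}`
  have hn : d * D = m * s := by rw [Nat.mul_comm d D, hs]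
  have hxspan : wordOfForm (Fin.revPerm : Equiv.Perm (Fin m)) D d F ∈ Submodule.span ℂ
      (Set.range fun e : Fin (d * D) ≃ Fin s × Fin m => wordBlockSign ℂ e) := by
    refine highestWeightSpace_wordRep_le_span_wordBlockSign hn _ ?_ hxHW
    funext i
    simp only [Weight.ofPartition_rectangle_apply, neg_neg, hsm]
  -- (5) `A x ∈ L (span S)`, hence `x ∈ L (span S)`
  have hAspan : A (wordOfForm (Fin.revPerm : Equiv.Perm (Fin m)) D d F) ∈
      (Submodule.span ℂ S).map L := by
    have h1 : A (wordOfForm (Fin.revPerm : Equiv.Perm (Fin m)) D d F) ∈ (Submodule.span ℂ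
        (Set.range fun e : Fin (d * D) ≃ Fin s × Fin m => wordBlockSign ℂ e)).map A :=
      Submodule.mem_map_of_mem hxspan
    rw [Submodule.map_span] at h1
    refine (Submodule.span_le.mpr ?_) h1
    rintro _ ⟨_, ⟨e, rfl⟩, rfl⟩
    obtain ⟨P, hP, hPe⟩ := hAζ e
    exact ⟨P, hP, (hL P).trans hPe⟩
  have hxL : wordOfForm (Fin.revPerm : Equiv.Perm (Fin m)) D d F ∈ (Submodule.span ℂ S).map L := by
    have h2 : wordOfForm (Fin.revPerm : Equiv.Perm (Fin m)) D d F =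
        c⁻¹ • A (wordOfForm (Fin.revPerm : Equiv.Perm (Fin m)) D d F) := by
      rw [hAinv _ hxinv, smul_smul, inv_mul_cancel₀ hc, one_smul]
    rw [h2]
    exact Submodule.smul_mem _ _ hAspan
  obtain ⟨G, hG, hGx⟩ := Submodule.mem_map.mp hxL
  -- `G` is a form of degree `d`, and `wordOfForm G = wordOfForm F`
  have hGh : G.IsHomogeneous d := by
    have hle : Submodule.span ℂ S ≤ homogeneousSubmodule (DegIdx (Fin m) D) ℂ d := by
      refine Submodule.span_le.mpr ?_
      rintro _ ⟨s', β, rfl⟩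
      exact (mem_homogeneousSubmodule _ _).mpr (isHomogeneous_tableauInvPoly β id)
    exact (mem_homogeneousSubmodule _ _).mp (hle hG)
  have hFG : F = G :=
    eq_of_wordOfForm_eq (Fin.revPerm : Equiv.Perm (Fin m)) hFh hGh ((hGx.symm).trans (hL G))
  rw [hFG]
  exact hG

/-! ### §4 Rem. 3.13 from the dictionary identity, two shapes -/

/-- **BI 2017 Rem. 3.13 ⇐ the dictionary identity, wreath shape.** If for all `m ≥ 1`, `D d = m s`
and every block structure `e : [dD] ≃ [s] × [m]` the wreath average
`Σ_{(π, ε) ∈ S_d × S_D^d} (outerBlockPerm π * innerBlockPerm ε) · ζ_e` of the block sign is the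
polarisation `wordOfForm rev D d P` of some `P ∈ span{P_β}` (the printed construction: `P_T` is the
symmetrisation over the wreath product of a product of `s` determinants, BI 2017 eq. (3.4) / §7),
then `BI2017_rem_3_13` holds. [cite: BurgisserIkenmeyer2017, Rem. 3.13] -/
theorem BI2017_rem_3_13_of_wreath_dictionary
    (hdict : ∀ (D d m s : ℕ), 0 < m → D * d = m * s → ∀ e : Fin (d * D) ≃ Fin s × Fin m,
      ∃ P ∈ Submodule.span ℂ {P : MvPolynomial (DegIdx (Fin m) D) ℂ |
          ∃ (s' : ℕ) (β : Fin D × Fin d ≃ Fin m × Fin s'), P = tableauInvPoly D β (id : Fin m → Fin m)},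
        wordOfForm (Fin.revPerm : Equiv.Perm (Fin m)) D d P =
          ∑ ω : Equiv.Perm (Fin d) × (Fin d → Equiv.Perm (Fin D)),
            wordPerm ℂ (outerBlockPerm d D ω.1 * innerBlockPerm d D ω.2) (wordBlockSign ℂ e)) :
    BI2017_rem_3_13 := by
  intro D d m F hm hFh hFi
  classical
  have hm0 : 0 < m := hm
  by_cases hdvd : m ∣ D * d
  · obtain ⟨s, hs⟩ := hdvd
    -- the averaging operator `A = Σ_ω ω·`
    let A : (Word m (d * D) → ℂ) →ₗ[ℂ] (Word m (d * D) → ℂ) :=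
      ∑ ω : Equiv.Perm (Fin d) × (Fin d → Equiv.Perm (Fin D)),
        wordPerm ℂ (outerBlockPerm d D ω.1 * innerBlockPerm d D ω.2)
    refine mem_span_tableauInvPoly_of_operator hm0 hs A
      (Fintype.card (Equiv.Perm (Fin d) × (Fin d → Equiv.Perm (Fin D))) : ℂ)
      (Nat.cast_ne_zero.mpr Fintype.card_ne_zero) (fun x hx => ?_) (fun e => ?_) F hFh hFi
    · rw [LinearMap.sum_apply, Finset.sum_congr rfl fun ω _ => hx _
        (Subgroup.mul_mem _ (outerBlockPerm_mem_blockPerms ω.1) (innerBlockPerm_mem_blockPerms ω.2)),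
        Finset.sum_const, Finset.card_univ, Nat.cast_smul_eq_nsmul]
    · obtain ⟨P, hP, hPe⟩ := hdict D d m s hm0 hs e
      exact ⟨P, hP, by rw [hPe, LinearMap.sum_apply]⟩
  · rw [eq_zero_of_isSLInvariantCoord_of_not_dvd hm0 hFh hFi hdvd]
    exact Submodule.zero_mem _

/-- **BI 2017 Rem. 3.13 ⇐ the dictionary identity, Reynolds shape** (the tree's
`blockSymmetrizer ℂ d D = Σ_{τ ∈ S_d ≀ S_D} τ·`): if every `blockSymmetrizer ℂ d D (ζ_e)` is the
polarisation of some `P ∈ span{P_β}`, then `BI2017_rem_3_13` holds. [cite: BurgisserIkenmeyer2017, Rem. 3.13] -/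
theorem BI2017_rem_3_13_of_blockSymmetrizer_dictionary
    (hdict : ∀ (D d m s : ℕ), 0 < m → D * d = m * s → ∀ e : Fin (d * D) ≃ Fin s × Fin m,
      ∃ P ∈ Submodule.span ℂ {P : MvPolynomial (DegIdx (Fin m) D) ℂ |
          ∃ (s' : ℕ) (β : Fin D × Fin d ≃ Fin m × Fin s'), P = tableauInvPoly D β (id : Fin m → Fin m)},
        wordOfForm (Fin.revPerm : Equiv.Perm (Fin m)) D d P =
          blockSymmetrizer ℂ d D (wordBlockSign ℂ e)) :
    BI2017_rem_3_13 := by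
  intro D d m F hm hFh hFi
  classical
  have hm0 : 0 < m := hm
  by_cases hdvd : m ∣ D * d
  · obtain ⟨s, hs⟩ := hdvd
    refine mem_span_tableauInvPoly_of_operator hm0 hs (blockSymmetrizer ℂ d D)
      ((blockPermsFinset d D).card : ℂ) (Nat.cast_ne_zero.mpr card_blockPermsFinset_pos.ne')
      (fun x hx => ?_) (hdict D d m s hm0 hs) F hFh hFi
    rw [blockSymmetrizer_apply_of_forall_wordPerm_eq (k := ℂ) hx, Nat.cast_smul_eq_nsmul]
  · rw [eq_zero_of_isSLInvariantCoord_of_not_dvd hm0 hFh hFi hdvd]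
    exact Submodule.zero_mem _

end Literature.Computability.AlgebraicComplexity

end
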